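import Summits.ValiantsHypothesis.ValiantsHypothesis.Theorems.FermionicJetQuadraticDcCdetPermSumsTwo

/-!
# Route `FermionicJet`, crux `QuadraticDcCdet` (stmt-ValiantsHypothesis-5343) — helper 4:
# the pattern operators of the Hessian of `cdet` in closed form

For `n = m + 3 ≥ 5` the Hessian of `cdet_n` at the all-ones matrix with `(p, q)` entry `3 - n`
(`p ≠ q`) is a non-zero multiple of the pattern matrix (helper 3)
`M_{(c,d),(a,b)} = [b ≠ d][a ≠ c] ( -(m-1) ε(a,b,c,d) + (m+1) [q ∉ {b,d}] [p ∉ {a,c}] ε(ρa,b,ρc,d) )`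
with `ε = 1` for the patterns `a = b ∧ c = d` / "no coincidence" and `-1` otherwise, `ρ q = p`,
`ρ = id` elsewhere.  This file writes the two pattern operators
`(E v)(c,d) = Σ_{a ≠ c, b ≠ d} ε(a,b,c,d) v(a,b)` and its `ρ`-transport `Ẽ` in CLOSED FORM, as affine
combinations of `v(c,d)`, a few transposed/neighbouring entries, the row sums `r_c = Σ_b v(c,b)`,
the column sums `k_d = Σ_a v(a,d)`, the trace `D = Σ_a v(a,a)` and the total `T = Σ v`
(`eps_sum_eq`, `epsT_sum_eq`), and hence `M *ᵥ v` (`patternMulVec_eq`).  The kernel computation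
(helpers 5–6) runs on these closed forms.
HONEST FRAMING: bookkeeping for a quadratic `dc` lower bound of a dormant route; nothing here bears
on `VP ≠ VNP`, which is NOT proved.
-/

noncomputable section

open Finset

-- layout Summits/ValiantsHypothesis/ValiantsHypothesis forces the duplicated namespace component
set_option linter.dupNamespace false

namespace Summit.ValiantsHypothesis.ValiantsHypothesis.Theorems.FermionicJet.CdetHessian

universe u v

variable {K : Type u} [CommRing K] {ι : Type v} [Fintype ι] [DecidableEq ι]

/-! ### Elementary double sums -/

/-- `Σ_a Σ_b [a = c] f a b = Σ_b f c b`. -/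
theorem sum_sum_ite_fst_eq (c : ι) (f : ι → ι → K) :
    (∑ a, ∑ b, if a = c then f a b else 0) = ∑ b, f c b := by
  rw [Finset.sum_comm]
  refine Finset.sum_congr rfl fun b _ => ?_
  rw [Finset.sum_ite_eq' Finset.univ c (fun a => f a b), if_pos (Finset.mem_univ _)]

/-- `Σ_a Σ_b [b = d] f a b = Σ_a f a d`. -/
theorem sum_sum_ite_snd_eq (d : ι) (f : ι → ι → K) :
    (∑ a, ∑ b, if b = d then f a b else 0) = ∑ a, f a d :=
  Finset.sum_congr rfl fun a _ => by
    rw [Finset.sum_ite_eq' Finset.univ d (fun b => f a b), if_pos (Finset.mem_univ _)]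

/-- `Σ_a Σ_b [b = g a] f a b = Σ_a f a (g a)`. -/
theorem sum_sum_ite_snd_eq_fun (g : ι → ι) (f : ι → ι → K) :
    (∑ a, ∑ b, if b = g a then f a b else 0) = ∑ a, f a (g a) :=
  Finset.sum_congr rfl fun a _ => by
    rw [Finset.sum_ite_eq' Finset.univ (g a) (fun b => f a b), if_pos (Finset.mem_univ _)]

/-- `Σ_a Σ_b [a = c ∧ b = d] f a b = f c d`. -/
theorem sum_sum_ite_eq_eq (c d : ι) (f : ι → ι → K) :
    (∑ a, ∑ b, if a = c ∧ b = d then f a b else 0) = f c d := by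
  rw [Finset.sum_eq_single_of_mem c (Finset.mem_univ _) (fun a _ hac =>
      Finset.sum_eq_zero (fun b _ => if_neg (fun h => hac h.1))),
    Finset.sum_eq_single_of_mem d (Finset.mem_univ _) (fun b _ hbd => if_neg (fun h => hbd h.2)),
    if_pos ⟨rfl, rfl⟩]

/-! ### The pattern operator `E` in closed form -/

omit [Fintype ι] in
/-- Pointwise form of the `ε`-pattern summand, off the diagonal `c ≠ d`. -/
theorem eps_summand_offdiag {c d : ι} (hcd : c ≠ d) (a b : ι) (x : K) :
    (if b = d ∨ a = c then 0 else
      (if (a = b ∧ c = d) ∨ ¬((a = b ∨ c = d) ∨ (a = d ∧ c = b)) then (1 : K) else -1) * x) =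
    x - (if a = c then x else 0) - (if b = d then x else 0) + (if a = c ∧ b = d then x else 0)
      - 2 * (if b = a then x else 0) + 2 * (if a = c ∧ b = c then x else 0)
      + 2 * (if a = d ∧ b = d then x else 0) - 2 * (if a = d ∧ b = c then x else 0) := by
  grind

omit [Fintype ι] in
/-- Pointwise form of the `ε`-pattern summand on the diagonal `c = d`. -/
theorem eps_summand_diag {c d : ι} (hcd : c = d) (a b : ι) (x : K) :
    (if b = d ∨ a = c then 0 else
      (if (a = b ∧ c = d) ∨ ¬((a = b ∨ c = d) ∨ (a = d ∧ c = b)) then (1 : K) else -1) * x) =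
    2 * (if b = a then x else 0) - 2 * (if a = c ∧ b = c then x else 0)
      - x + (if a = c then x else 0) + (if b = c then x else 0) - (if a = c ∧ b = c then x else 0)
      := by
  grind

/-- **The pattern operator `E` in closed form.** With `T = Σ v`, `r_c = Σ_b v(c,b)`,
`k_d = Σ_a v(a,d)`, `D = Σ_a v(a,a)`:
`(E v)(c,c) = 2D - 3v(c,c) - (T - r_c - k_c)` and, for `c ≠ d`,
`(E v)(c,d) = (T - r_c - k_d + v(c,d)) - 2(D - v(c,c) - v(d,d)) - 2 v(d,c)`. -/
theorem eps_sum_eq (v : ι × ι → K) (c d : ι) :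
    (∑ a, ∑ b, if b = d ∨ a = c then 0 else
      (if (a = b ∧ c = d) ∨ ¬((a = b ∨ c = d) ∨ (a = d ∧ c = b)) then (1 : K) else -1) * v (a, b)) =
    if c = d then
      2 * (∑ a, v (a, a)) - 3 * v (c, c) - ((∑ x, v x) - (∑ b, v (c, b)) - ∑ a, v (a, c))
    else
      ((∑ x, v x) - (∑ b, v (c, b)) - (∑ a, v (a, d)) + v (c, d))
        - 2 * ((∑ a, v (a, a)) - v (c, c) - v (d, d)) - 2 * v (d, c) := by
  have hT : (∑ x, v x) = ∑ a, ∑ b, v (a, b) := Fintype.sum_prod_type _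
  have hD : (∑ a, v (a, a)) = ∑ a, ∑ b, if b = a then v (a, b) else 0 := by
    rw [sum_sum_ite_snd_eq_fun (fun a => a) (fun a b => v (a, b))]
  by_cases hcd : c = d
  · rw [if_pos hcd, Finset.sum_congr rfl fun a _ => Finset.sum_congr rfl fun b _ =>
      eps_summand_diag hcd a b (v (a, b))]
    simp only [Finset.sum_sub_distrib, Finset.sum_add_distrib, ← Finset.mul_sum]
    rw [sum_sum_ite_eq_eq, sum_sum_ite_fst_eq, sum_sum_ite_snd_eq, ← hD, ← hT]
    ring
  · rw [if_neg hcd, Finset.sum_congr rfl fun a _ => Finset.sum_congr rfl fun b _ =>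
      eps_summand_offdiag hcd a b (v (a, b))]
    simp only [Finset.sum_sub_distrib, Finset.sum_add_distrib, ← Finset.mul_sum]
    rw [sum_sum_ite_eq_eq, sum_sum_ite_eq_eq, sum_sum_ite_eq_eq, sum_sum_ite_eq_eq,
      sum_sum_ite_fst_eq, sum_sum_ite_snd_eq, ← hD, ← hT]
    ring

/-! ### The transported pattern operator `Ẽ` in closed form -/

/-- `Σ_a Σ_b [b = g a ∧ a = c] f a b = f c (g c)`. -/
theorem sum_sum_ite_snd_fun_and_fst (g : ι → ι) (c : ι) (f : ι → ι → K) :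
    (∑ a, ∑ b, if b = g a ∧ a = c then f a b else 0) = f c (g c) := by
  rw [Finset.sum_eq_single_of_mem c (Finset.mem_univ _) (fun a _ hac =>
      Finset.sum_eq_zero (fun b _ => if_neg (fun h => hac h.2))),
    Finset.sum_eq_single_of_mem (g c) (Finset.mem_univ _) (fun b _ hb => if_neg (fun h => hb h.1)),
    if_pos ⟨rfl, rfl⟩]

omit [Fintype ι] in
/-- Pointwise form of the transported summand when `ρ c = d` ("diagonal" of the contracted index
set). -/
theorem epsT_summand_diag {p q c d : ι} (hpq : p ≠ q) (hc : c ≠ p) (hd : d ≠ q)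
    (hρ : (if c = q then p else c) = d) (a b : ι) (x : K) :
    (if b = d ∨ a = c then 0 else if q = b ∨ q = d ∨ a = p ∨ c = p then 0 else
      if (if a = q then p else a) = (if c = q then p else c) then 0 else
      (if ((if a = q then p else a) = b ∧ (if c = q then p else c) = d) ∨
          ¬(((if a = q then p else a) = b ∨ (if c = q then p else c) = d) ∨
            ((if a = q then p else a) = d ∧ (if c = q then p else c) = b)) then (1 : K) else -1) * x) =
    2 * (if b = (if a = q then p else a) then x else 0)
      - 2 * (if b = (if a = q then p else a) ∧ a = p then x else 0)
      - 2 * (if b = (if a = q then p else a) ∧ a = c then x else 0)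
      - (x - (if a = c then x else 0) - (if a = p then x else 0) - (if b = d then x else 0)
          - (if b = q then x else 0) + (if a = c ∧ b = d then x else 0)
          + (if a = c ∧ b = q then x else 0) + (if a = p ∧ b = d then x else 0)
          + (if a = p ∧ b = q then x else 0)) := by
  grind (splits := 40)

omit [Fintype ι] in
/-- Pointwise form of the transported summand when `ρ c ≠ d`. -/
theorem epsT_summand_offdiag {p q c d : ι} (hpq : p ≠ q) (hc : c ≠ p) (hd : d ≠ q)
    (hρ : (if c = q then p else c) ≠ d) (a b : ι) (x : K) :
    (if b = d ∨ a = c then 0 else if q = b ∨ q = d ∨ a = p ∨ c = p then 0 else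
      if (if a = q then p else a) = (if c = q then p else c) then 0 else
      (if ((if a = q then p else a) = b ∧ (if c = q then p else c) = d) ∨
          ¬(((if a = q then p else a) = b ∨ (if c = q then p else c) = d) ∨
            ((if a = q then p else a) = d ∧ (if c = q then p else c) = b)) then (1 : K) else -1) * x) =
    (x - (if a = c then x else 0) - (if a = p then x else 0) - (if b = d then x else 0)
        - (if b = q then x else 0) + (if a = c ∧ b = d then x else 0)
        + (if a = c ∧ b = q then x else 0) + (if a = p ∧ b = d then x else 0)
        + (if a = p ∧ b = q then x else 0))
      - 2 * (if b = (if a = q then p else a) then x else 0)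
      + 2 * (if b = (if a = q then p else a) ∧ a = p then x else 0)
      + 2 * (if b = (if a = q then p else a) ∧ a = c then x else 0)
      + 2 * (if b = (if a = q then p else a) ∧ a = (if d = p then q else d) then x else 0)
      - 2 * (if a = (if d = p then q else d) ∧ b = (if c = q then p else c) then x else 0) := by
  grind (splits := 40)

/-- **The transported pattern operator `Ẽ` in closed form** (`p ≠ q`; `ρ c = p` if `c = q`, else
`c`; `ρ⁻¹ d = q` if `d = p`, else `d`).  It vanishes on row `p` and column `q`; otherwise, with
`T°_{cd} = T - r_c - r_p - k_d - k_q + v(c,d) + v(c,q) + v(p,d) + v(p,q)` and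
`D° = Σ_a v(a, ρ a) - v(p,p)`: if `ρ c = d` it is `2 D° - 2 v(c,d) - T°_{cd}`, else
`T°_{cd} - 2(D° - v(c, ρc) - v(ρ⁻¹d, d)) - 2 v(ρ⁻¹ d, ρ c)`. -/
theorem epsT_sum_eq (v : ι × ι → K) {p q : ι} (hpq : p ≠ q) (c d : ι) :
    (∑ a, ∑ b, if b = d ∨ a = c then 0 else if q = b ∨ q = d ∨ a = p ∨ c = p then 0 else
      if (if a = q then p else a) = (if c = q then p else c) then 0 else
      (if ((if a = q then p else a) = b ∧ (if c = q then p else c) = d) ∨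
          ¬(((if a = q then p else a) = b ∨ (if c = q then p else c) = d) ∨
            ((if a = q then p else a) = d ∧ (if c = q then p else c) = b)) then (1 : K) else -1) *
        v (a, b)) =
    if d = q ∨ c = p then 0 else
      if (if c = q then p else c) = d then
        2 * ((∑ a, v (a, if a = q then p else a)) - v (p, p)) - 2 * v (c, d)
          - ((∑ x, v x) - (∑ b, v (c, b)) - (∑ b, v (p, b)) - (∑ a, v (a, d)) - (∑ a, v (a, q))
              + v (c, d) + v (c, q) + v (p, d) + v (p, q))
      else
        ((∑ x, v x) - (∑ b, v (c, b)) - (∑ b, v (p, b)) - (∑ a, v (a, d)) - (∑ a, v (a, q))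
            + v (c, d) + v (c, q) + v (p, d) + v (p, q))
          - 2 * ((∑ a, v (a, if a = q then p else a)) - v (p, p) - v (c, if c = q then p else c)
              - v ((if d = p then q else d), d))
          - 2 * v ((if d = p then q else d), (if c = q then p else c)) := by
  have hT : (∑ x, v x) = ∑ a, ∑ b, v (a, b) := Fintype.sum_prod_type _
  by_cases h0 : d = q ∨ c = p
  · rw [if_pos h0]
    refine Finset.sum_eq_zero fun a _ => Finset.sum_eq_zero fun b _ => ?_
    by_cases h1 : b = d ∨ a = c
    · rw [if_pos h1]
    · rw [if_neg h1, if_pos (by tauto)]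
  rw [if_neg h0]
  have hd : d ≠ q := fun h => h0 (Or.inl h)
  have hc : c ≠ p := fun h => h0 (Or.inr h)
  have hpp : v (p, if p = q then p else p) = v (p, p) := by rw [if_neg hpq]
  have hdd : (if (if d = p then q else d) = q then p else (if d = p then q else d)) = d := by
    by_cases hdp : d = p
    · rw [if_pos hdp, if_pos rfl, hdp]
    · rw [if_neg hdp, if_neg hd]
  by_cases hρ : (if c = q then p else c) = d
  · rw [if_pos hρ, Finset.sum_congr rfl fun a _ => Finset.sum_congr rfl fun b _ =>
      epsT_summand_diag hpq hc hd hρ a b (v (a, b))]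
    simp only [Finset.sum_sub_distrib, Finset.sum_add_distrib, ← Finset.mul_sum]
    simp only [sum_sum_ite_snd_eq_fun, sum_sum_ite_snd_fun_and_fst, sum_sum_ite_fst_eq,
      sum_sum_ite_eq_eq, hpp]
    rw [← hT, hρ]
    ring
  · rw [if_neg hρ, Finset.sum_congr rfl fun a _ => Finset.sum_congr rfl fun b _ =>
      epsT_summand_offdiag hpq hc hd hρ a b (v (a, b))]
    simp only [Finset.sum_sub_distrib, Finset.sum_add_distrib, ← Finset.mul_sum]
    simp only [sum_sum_ite_snd_eq_fun, sum_sum_ite_snd_fun_and_fst, sum_sum_ite_fst_eq,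
      sum_sum_ite_eq_eq, hpp, hdd]
    rw [← hT]
    ring

/-! ### The pattern matrix applied to a vector -/

/-- **`M *ᵥ v` in closed form.** For the pattern matrix
`M_{(c,d),(a,b)} = [b ≠ d][a ≠ c] (α ε(a,b,c,d) + β [q ∉ {b,d}][p ∉ {a,c}][ρa ≠ ρc] ε(ρa,b,ρc,d))`
one has `(M *ᵥ v)(c,d) = α (E v)(c,d) + β (Ẽ v)(c,d)` with the closed forms `eps_sum_eq`,
`epsT_sum_eq`. -/
theorem patternMulVec_apply {p q : ι} (hpq : p ≠ q) (α β : K)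
    (M : Matrix (ι × ι) (ι × ι) K)
    (hM : ∀ a b c d : ι, M (c, d) (a, b) = if b = d ∨ a = c then 0 else
      α * (if (a = b ∧ c = d) ∨ ¬((a = b ∨ c = d) ∨ (a = d ∧ c = b)) then (1 : K) else -1) +
      β * (if q = b ∨ q = d ∨ a = p ∨ c = p then 0 else
        if (if a = q then p else a) = (if c = q then p else c) then 0 else
        (if ((if a = q then p else a) = b ∧ (if c = q then p else c) = d) ∨
          ¬(((if a = q then p else a) = b ∨ (if c = q then p else c) = d) ∨
            ((if a = q then p else a) = d ∧ (if c = q then p else c) = b)) then (1 : K) else -1)))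
    (v : ι × ι → K) (c d : ι) :
    (M.mulVec v) (c, d) =
      α * (if c = d then
          2 * (∑ a, v (a, a)) - 3 * v (c, c) - ((∑ x, v x) - (∑ b, v (c, b)) - ∑ a, v (a, c))
        else
          ((∑ x, v x) - (∑ b, v (c, b)) - (∑ a, v (a, d)) + v (c, d))
            - 2 * ((∑ a, v (a, a)) - v (c, c) - v (d, d)) - 2 * v (d, c)) +
      β * (if d = q ∨ c = p then 0 else
        if (if c = q then p else c) = d then
          2 * ((∑ a, v (a, if a = q then p else a)) - v (p, p)) - 2 * v (c, d)
            - ((∑ x, v x) - (∑ b, v (c, b)) - (∑ b, v (p, b)) - (∑ a, v (a, d)) - (∑ a, v (a, q))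
                + v (c, d) + v (c, q) + v (p, d) + v (p, q))
        else
          ((∑ x, v x) - (∑ b, v (c, b)) - (∑ b, v (p, b)) - (∑ a, v (a, d)) - (∑ a, v (a, q))
              + v (c, d) + v (c, q) + v (p, d) + v (p, q))
            - 2 * ((∑ a, v (a, if a = q then p else a)) - v (p, p) - v (c, if c = q then p else c)
                - v ((if d = p then q else d), d))
            - 2 * v ((if d = p then q else d), (if c = q then p else c))) := by
  rw [← eps_sum_eq v c d, ← epsT_sum_eq v hpq c d, Matrix.mulVec, dotProduct,
    Fintype.sum_prod_type, Finset.mul_sum, Finset.mul_sum, ← Finset.sum_add_distrib]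
  refine Finset.sum_congr rfl fun a _ => ?_
  rw [Finset.mul_sum, Finset.mul_sum, ← Finset.sum_add_distrib]
  refine Finset.sum_congr rfl fun b _ => ?_
  rw [hM a b c d]
  split_ifs <;> ring

end Summit.ValiantsHypothesis.ValiantsHypothesis.Theorems.FermionicJet.CdetHessian
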